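import Mathlib
import HarnessLib

/-!
# Normal coordinates along an immersed `J`-holomorphic sheet (the sheet chart)

The coordinates in which positivity of intersections of `J`-holomorphic curves is proved
(McDuff (1991), Lemma 2.5: "change coordinates so that `J = J₀` along the axis `{v = 0}`";
McDuff–Salamon (2012), §2.4 and App. E; Wendl (2020), App. B §B.2): given a
smooth map `b : ℂ → F` into a real normed space with a smooth field of operators
`J : F → (F →L[ℝ] F)`, and a fixed vector `ν₀ : F`, the **sheet chart**

  `sheetChart J b ν₀ (z, w) := b z + (Re w) • ν₀ + (Im w) • J (b z) ν₀`

restricts to `b` on `{w = 0}` and, wherever `b` is `J`-holomorphic (`db (i α) = J (b z) (db α)`)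
and `J (b z)² = -1`, its differential along `{w = 0}` is `J`-complex-linear:
`J (b z) ∘ dE_{(z,0)} = dE_{(z,0)} ∘ (i ⊕ i)` — exactly the hypothesis `hhol` of the scalar
reduction `Literature.Geometry.Symplectic.sheetDbarInequality`
(`Literature/Geometry/Symplectic/JHolomorphicSheetDbar.lean`). If moreover `dim F = 4`, `b` is
immersed at `z₁` and `ν₀` is chosen off the (complex) tangent line `db_{z₁}(ℂ)`, then `dE_{(z₁,0)}`
is bijective (`exists_bijective_fderiv_sheetChart`), so `E` is a local diffeomorphism at
`(z₁, 0)` (inverse function theorem, used downstream).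

## Contents (namespace `Literature.Geometry.Symplectic`)

* `sheetChart`, `sheetChart_apply`, `sheetChart_mk_zero`, `contDiff_sheetChart`;
* `sheetChartDeriv J b ν₀ z` — the explicit differential along `{w = 0}` and
  `hasFDerivAt_sheetChart` (`dE_{(z,0)} (α, β) = db_z α + (Re β) • ν₀ + (Im β) • J (b z) ν₀`);
* `sheetChartDeriv_hol` — `J`-complex-linearity along `{w = 0}`;
* `exists_not_mem_range_fderiv` (a vector off the tangent line, `finrank F = 4`),
  `injective_sheetChartDeriv` (then `dE_{(z₁,0)}` is injective), `exists_bijective_fderiv_sheetChart`.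

## References

* D. McDuff, D. Salamon, *J-holomorphic curves and symplectic topology*, 2nd ed. (2012), §2.4,
  App. E. [McDuffSalamon2012]
* D. McDuff, *The local behaviour of holomorphic curves in almost complex 4-manifolds*,
  J. Differential Geom. 34 (1991), §2 (Lemma 2.5: standard identifications). [McDuff1991LocalBehaviour]
-/

noncomputable section

open scoped ContDiff Topology
open Set Function

namespace Literature.Geometry.Symplectic

variable {F : Type*} [NormedAddCommGroup F] [NormedSpace ℝ F]

/-- The **sheet chart** along a map `b : ℂ → F` for the operator field `J` and the normal vector
`ν₀`: `(z, w) ↦ b z + (Re w) • ν₀ + (Im w) • J (b z) ν₀` (McDuff 1991, Lemma 2.5: coordinates in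
which the first curve is the axis `{w = 0}` and `J` is standard along it in the normal
direction; here only `J`-complex-linearity of the differential along the axis is arranged). [cite: McDuff1991LocalBehaviour, Lemma 2.5] -/
def sheetChart (J : F → F →L[ℝ] F) (b : ℂ → F) (ν₀ : F) : ℂ × ℂ → F :=
  fun p => b p.1 + p.2.re • ν₀ + p.2.im • J (b p.1) ν₀

/-- Unfolding `sheetChart`. [folklore] -/
@[simp] theorem sheetChart_apply (J : F → F →L[ℝ] F) (b : ℂ → F) (ν₀ : F) (p : ℂ × ℂ) :
    sheetChart J b ν₀ p = b p.1 + p.2.re • ν₀ + p.2.im • J (b p.1) ν₀ := rfl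

/-- On the axis `{w = 0}` the sheet chart is the sheet `b`. [folklore] -/
@[simp] theorem sheetChart_mk_zero (J : F → F →L[ℝ] F) (b : ℂ → F) (ν₀ : F) (z : ℂ) :
    sheetChart J b ν₀ (z, 0) = b z := by
  simp [sheetChart]

/-- The sheet chart is smooth when `J` and `b` are. [folklore] -/
theorem contDiff_sheetChart {J : F → F →L[ℝ] F} {b : ℂ → F} (hJ : ContDiff ℝ ∞ J)
    (hb : ContDiff ℝ ∞ b) (ν₀ : F) : ContDiff ℝ ∞ (sheetChart J b ν₀) := by
  have h1 : ContDiff ℝ ∞ fun p : ℂ × ℂ => b p.1 := hb.comp contDiff_fst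
  have h2 : ContDiff ℝ ∞ fun p : ℂ × ℂ => p.2.re • ν₀ :=
    (Complex.reCLM.contDiff.comp contDiff_snd).smul contDiff_const
  have h3 : ContDiff ℝ ∞ fun p : ℂ × ℂ => p.2.im • J (b p.1) ν₀ :=
    (Complex.imCLM.contDiff.comp contDiff_snd).smul ((hJ.comp h1).clm_apply contDiff_const)
  exact (h1.add h2).add h3

/-- The differential of the sheet chart at a point `(z, 0)` of the axis:
`(α, β) ↦ db_z α + (Re β) • ν₀ + (Im β) • J (b z) ν₀`. [folklore] -/
def sheetChartDeriv (J : F → F →L[ℝ] F) (b : ℂ → F) (ν₀ : F) (z : ℂ) : ℂ × ℂ →L[ℝ] F :=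
  (fderiv ℝ b z).comp (ContinuousLinearMap.fst ℝ ℂ ℂ) +
    ((Complex.reCLM.comp (ContinuousLinearMap.snd ℝ ℂ ℂ)).smulRight ν₀ +
      (Complex.imCLM.comp (ContinuousLinearMap.snd ℝ ℂ ℂ)).smulRight (J (b z) ν₀))

/-- Unfolding `sheetChartDeriv`. [folklore] -/
@[simp] theorem sheetChartDeriv_apply (J : F → F →L[ℝ] F) (b : ℂ → F) (ν₀ : F) (z : ℂ)
    (q : ℂ × ℂ) :
    sheetChartDeriv J b ν₀ z q = fderiv ℝ b z q.1 + q.2.re • ν₀ + q.2.im • J (b z) ν₀ := by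
  simp [sheetChartDeriv, add_assoc]

/-- **The differential of the sheet chart along the axis.** If `b` is differentiable at `z` and
`x ↦ J x ν₀` is differentiable at `b z`, then `d(sheetChart)_{(z,0)} = sheetChartDeriv J b ν₀ z`
(the term `(Im w) • d(J (b ·) ν₀)` drops out because `Im 0 = 0`). [folklore] -/
theorem hasFDerivAt_sheetChart {J : F → F →L[ℝ] F} {b : ℂ → F} {ν₀ : F} {z : ℂ}
    (hb : DifferentiableAt ℝ b z) (hJ : DifferentiableAt ℝ (fun x => J x ν₀) (b z)) :
    HasFDerivAt (sheetChart J b ν₀) (sheetChartDeriv J b ν₀ z) (z, 0) := by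
  -- the three summands
  have h1 : HasFDerivAt (fun p : ℂ × ℂ => b p.1)
      ((fderiv ℝ b z).comp (ContinuousLinearMap.fst ℝ ℂ ℂ)) (z, 0) :=
    HasFDerivAt.comp ((z, (0 : ℂ)) : ℂ × ℂ) (hb.hasFDerivAt) hasFDerivAt_fst
  have h2 : HasFDerivAt (fun p : ℂ × ℂ => p.2.re • ν₀)
      ((Complex.reCLM.comp (ContinuousLinearMap.snd ℝ ℂ ℂ)).smulRight ν₀) (z, 0) := by
    have : (fun p : ℂ × ℂ => p.2.re • ν₀) =
        fun p => ((Complex.reCLM.comp (ContinuousLinearMap.snd ℝ ℂ ℂ)).smulRight ν₀) p := by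
      funext p; simp
    rw [this]
    exact ContinuousLinearMap.hasFDerivAt _
  -- scalar factor `p.2.im` (vanishing at the point) times the vector field `J (b p.1) ν₀`
  have hs : HasFDerivAt (fun p : ℂ × ℂ => p.2.im)
      (Complex.imCLM.comp (ContinuousLinearMap.snd ℝ ℂ ℂ)) (z, 0) := by
    have : (fun p : ℂ × ℂ => p.2.im) =
        fun p => (Complex.imCLM.comp (ContinuousLinearMap.snd ℝ ℂ ℂ)) p := by
      funext p; simp
    rw [this]
    exact ContinuousLinearMap.hasFDerivAt _
  have hV : HasFDerivAt ((fun x => J x ν₀) ∘ fun p : ℂ × ℂ => b p.1)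
      ((fderiv ℝ (fun x => J x ν₀) (b z)).comp
        ((fderiv ℝ b z).comp (ContinuousLinearMap.fst ℝ ℂ ℂ))) (z, 0) :=
    hJ.hasFDerivAt.comp ((z, (0 : ℂ)) : ℂ × ℂ) h1
  have h3 := hs.smul hV
  simp only [Complex.zero_im, zero_smul, zero_add] at h3
  have h := (h1.add h2).add h3
  refine h.congr_fderiv ?_
  ext q <;> simp [sheetChartDeriv]

/-- **`J`-complex-linearity of the sheet chart along the axis.** If `db_z (i α) = J (b z) (db_z α)`
for all `α` (`b` is `J`-holomorphic at `z`) and `J (b z)² = -1`, then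
`J (b z) ∘ dE_{(z,0)} = dE_{(z,0)} ∘ (i ⊕ i)`; this is hypothesis `hhol` of
`Literature.Geometry.Symplectic.sheetDbarInequality` (note `sheetChart J b ν₀ (z, 0) = b z`).
[cite: McDuff1991LocalBehaviour, Lemma 2.5] -/
theorem sheetChartDeriv_hol {J : F → F →L[ℝ] F} {b : ℂ → F} {ν₀ : F} {z : ℂ}
    (hbJ : ∀ α : ℂ, fderiv ℝ b z (Complex.I * α) = J (b z) (fderiv ℝ b z α))
    (hJ2 : ∀ v : F, J (b z) (J (b z) v) = -v) (α β : ℂ) :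
    J (b z) (sheetChartDeriv J b ν₀ z (α, β)) =
      sheetChartDeriv J b ν₀ z (Complex.I * α, Complex.I * β) := by
  simp only [sheetChartDeriv_apply, map_add, map_smul, hbJ, hJ2, Complex.mul_re, Complex.I_re,
    zero_mul, Complex.I_im, one_mul, zero_sub, Complex.mul_im, neg_smul, smul_neg]
  abel

/-! ### Choice of the normal vector and invertibility of the differential (`dim F = 4`) -/

section FourDimensional

/-- The real tangent plane `db_z(ℂ)` of an immersed sheet is `2`-dimensional, so in a
`4`-dimensional `F` there is a vector off it. [folklore] -/
theorem exists_not_mem_range_fderiv (h4 : Module.finrank ℝ F = 4) (L : ℂ →L[ℝ] F) :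
    ∃ ν₀ : F, ν₀ ∉ LinearMap.range (L : ℂ →ₗ[ℝ] F) := by
  by_contra h
  push Not at h
  have htop : LinearMap.range (L : ℂ →ₗ[ℝ] F) = ⊤ := Submodule.eq_top_iff'.2 h
  have h1 : Module.finrank ℝ (LinearMap.range (L : ℂ →ₗ[ℝ] F)) ≤ Module.finrank ℝ ℂ :=
    LinearMap.finrank_range_le _
  rw [htop, finrank_top, h4, Complex.finrank_real_complex] at h1
  omega

/-- **Injectivity of the differential of the sheet chart at an immersed `J`-holomorphic point.**
If `db_{z}` is injective and `J`-complex-linear (`db (iα) = J (db α)`), `J (b z)² = -1`, and `ν₀`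
is not tangent (`ν₀ ∉ db_z(ℂ)`), then `dE_{(z,0)}` is injective: from
`db α + a ν₀ + c Jν₀ = 0` one gets `u := a ν₀ + c Jν₀ ∈ db_z(ℂ)` and, applying `J`,
`a Jν₀ - c ν₀ ∈ db_z(ℂ)`, whence `(a² + c²) ν₀ ∈ db_z(ℂ)`, so `a = c = 0` and then `α = 0`.
[folklore] -/
theorem injective_sheetChartDeriv {J : F → F →L[ℝ] F} {b : ℂ → F} {ν₀ : F} {z : ℂ}
    (hinj : Injective (fderiv ℝ b z))
    (hbJ : ∀ α : ℂ, fderiv ℝ b z (Complex.I * α) = J (b z) (fderiv ℝ b z α))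
    (hJ2 : ∀ v : F, J (b z) (J (b z) v) = -v)
    (hν₀ : ν₀ ∉ LinearMap.range ((fderiv ℝ b z : ℂ →L[ℝ] F) : ℂ →ₗ[ℝ] F)) :
    Injective (sheetChartDeriv J b ν₀ z) := by
  set L : ℂ →L[ℝ] F := fderiv ℝ b z with hL
  set R : Submodule ℝ F := LinearMap.range (L : ℂ →ₗ[ℝ] F) with hR
  have hmem : ∀ α : ℂ, L α ∈ R := fun α => LinearMap.mem_range_self _ α
  -- `R` is `J`-invariant
  have hJR : ∀ u ∈ R, J (b z) u ∈ R := by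
    rintro u ⟨α, rfl⟩
    exact ⟨Complex.I * α, (hbJ α).trans rfl⟩
  refine (injective_iff_map_eq_zero _).2 fun q hq => ?_
  obtain ⟨α, β⟩ := q
  rw [sheetChartDeriv_apply] at hq
  simp only at hq
  -- `u := (Re β) ν₀ + (Im β) J ν₀ ∈ R`
  set a : ℝ := β.re
  set c : ℝ := β.im
  have hu : a • ν₀ + c • J (b z) ν₀ ∈ R := by
    have : a • ν₀ + c • J (b z) ν₀ = -L α := by
      rw [eq_neg_iff_add_eq_zero, add_comm, ← add_assoc]; exact hq
    rw [this]
    exact R.neg_mem (hmem α)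
  -- apply `J`: `a Jν₀ - c ν₀ ∈ R`
  have hu' : a • J (b z) ν₀ - c • ν₀ ∈ R := by
    have h := hJR _ hu
    rw [map_add, map_smul, map_smul, hJ2, smul_neg, ← sub_eq_add_neg] at h
    exact h
  -- combine: `(a² + c²) ν₀ ∈ R`
  have hcomb : (a ^ 2 + c ^ 2) • ν₀ ∈ R := by
    have h := R.sub_mem (R.smul_mem a hu) (R.smul_mem c hu')
    have e : a • (a • ν₀ + c • J (b z) ν₀) - c • (a • J (b z) ν₀ - c • ν₀) =
        (a ^ 2 + c ^ 2) • ν₀ := by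
      simp only [smul_add, smul_sub, smul_smul, add_smul, sq]
      rw [mul_comm c a]
      abel
    rwa [e] at h
  have hac : a ^ 2 + c ^ 2 = 0 := by
    by_contra hne
    have h := R.smul_mem (a ^ 2 + c ^ 2)⁻¹ hcomb
    rw [smul_smul, inv_mul_cancel₀ hne, one_smul] at h
    exact hν₀ h
  have ha : a = 0 := by nlinarith [sq_nonneg a, sq_nonneg c]
  have hc : c = 0 := by nlinarith [sq_nonneg a, sq_nonneg c]
  have hβ : β = 0 := Complex.ext (by simpa using ha) (by simpa using hc)
  have hα : α = 0 := by
    have h0 : L α = 0 := by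
      have h := hq
      rw [ha, hc, zero_smul, zero_smul, add_zero, add_zero] at h
      exact h
    exact hinj (by rw [h0, map_zero])
  simp [hα, hβ]

/-- **The sheet chart is a local diffeomorphism at an immersed `J`-holomorphic point
(`dim F = 4`).** For `b` immersed and `J`-holomorphic at `z₁` with `J (b z₁)² = -1` there is a
normal vector `ν₀` for which `d(sheetChart J b ν₀)_{(z₁,0)}` is bijective. [folklore] -/
theorem exists_bijective_sheetChartDeriv [FiniteDimensional ℝ F] (h4 : Module.finrank ℝ F = 4)
    {J : F → F →L[ℝ] F}
    {b : ℂ → F} {z₁ : ℂ} (hinj : Injective (fderiv ℝ b z₁))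
    (hbJ : ∀ α : ℂ, fderiv ℝ b z₁ (Complex.I * α) = J (b z₁) (fderiv ℝ b z₁ α))
    (hJ2 : ∀ v : F, J (b z₁) (J (b z₁) v) = -v) :
    ∃ ν₀ : F, Bijective (sheetChartDeriv J b ν₀ z₁) := by
  obtain ⟨ν₀, hν₀⟩ := exists_not_mem_range_fderiv h4 (fderiv ℝ b z₁)
  have hi := injective_sheetChartDeriv hinj hbJ hJ2 hν₀
  refine ⟨ν₀, hi, ?_⟩
  -- injective linear map between spaces of the same finite dimension `4`
  have hdim : Module.finrank ℝ (ℂ × ℂ) = Module.finrank ℝ F := by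
    rw [Module.finrank_prod, Complex.finrank_real_complex, h4]
  exact (LinearMap.injective_iff_surjective_of_finrank_eq_finrank hdim
    (f := (sheetChartDeriv J b ν₀ z₁ : ℂ × ℂ →ₗ[ℝ] F))).1 hi

end FourDimensional

end Literature.Geometry.Symplectic

end
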